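import Summits.QuantumFields.YangMills.Theorems.IR.Negative.HairpinStokes.Algebra

/-!
# Crux `IR` (stmt-QuantumFields-19354) — HAIRPIN STOKES for the layer comb, part 2/3: counting and the twisted configuration
# plaquette by plaquette (sections `Counting`, `TopFace`)

Re-homed VERBATIM (statements, proofs, names; namespace `…Cruxes.IR.CruxIdea2g7Hairpin` ↦ `…Cruxes.IR.HairpinStokes`) from the
crux workfile `Cruxes/IR/CruxIdea2HairpinStokes.lean` rev 3 (sha16 9564a081d3085d3d; author `ym-cruxidea-19354-2` GEN 7) per owner
R114 (2) (landing seat: the `ym-19354-disprove-1` lineage, g9), split by its sections into three ≤ 400-line modules chained by import;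
the author's module docstring of record is reproduced in part 1/3 `Theorems/IR/Negative/HairpinStokes/Algebra.lean`.
Negative knowledge for stmt-QuantumFields-19354 (`--supports`; closes no stub); not mixing, not a mass gap, nothing about Clay.
-/

set_option autoImplicit false

noncomputable section

open Literature.MathematicalPhysics.QuantumLattice
open Literature.Probability.LatticeModels
open Summit.QuantumFields.YangMills.Cruxes.IR.FixedMeshAllG
open Summit.QuantumFields.YangMills.Theorems.FemtoCurvatureTwoPoint.DoublingOfRV (norm_rho_mul_sub_one_le norm_rho_inv_sub_one)

namespace Summit.QuantumFields.YangMills.Cruxes.IR.HairpinStokes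

section Counting

/-- Length bookkeeping: inside the window `x l ≤ R` each comb segment has at most `2R` steps, so a hairpin sweeps at
most `4R` layer plaquettes. -/
theorem combLen_le {R : ℕ} {x : Site 4} {l : Fin 4} (h : x l ≤ (R : ℤ)) : combLen R x l ≤ 2 * R := by
  unfold combLen
  omega


/-! ### The top-face count (toward R1d): plaquettes touching the row region with base point at height `b` -/

open Summit.QuantumFields.YangMills.Cruxes.IR.Tempered (cellEdges windowCells regionEdges)
open Summit.QuantumFields.YangMills.Cruxes.IR.FixedMesh

/-- Spatial range of an edge of a standard-frame cell. -/
theorem spatial_of_mem_cellEdges {b : ℕ} {c : Fin 4 → ℤ} {e : ZdEdge 4} (he : e ∈ cellEdges (stdFrame b) c)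
    {i : Fin 4} (hi : i ≠ 0) : (b : ℤ) * c i ≤ e.1 i ∧ e.1 i < (b : ℤ) * (c i + 1) := by
  have h := Fintype.mem_piFinset.1 (Finset.mem_product.1 he).1 i
  have h' := Finset.mem_Ico.1 h
  simp only [stdFrame, if_neg hi] at h'
  exact h'

/-- The bounding box of the row region `Λ = rowRegion b n`: heights `1 … b`, spatial coordinates in
`[-2nb, (2n+1)b - 1]`. -/
theorem box_of_mem_rowRegion {b n : ℕ} {e : ZdEdge 4} (he : e ∈ rowRegion b n) :
    (1 ≤ e.1 0 ∧ e.1 0 ≤ (b : ℤ)) ∧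
      ∀ i : Fin 4, i ≠ 0 → -(2 * (n : ℤ) * b) ≤ e.1 i ∧ e.1 i ≤ (2 * (n : ℤ) + 1) * b - 1 := by
  unfold rowRegion regionEdges at he
  obtain ⟨c, hc, hec⟩ := Finset.mem_biUnion.1 he
  have hcw := Finset.mem_filter.1 (show c ∈ (windowCells n).filter (fun y => y 0 = 0) from hc)
  have hc0 : c 0 = 0 := hcw.2
  have hcI : ∀ i, -(2 * (n : ℤ)) ≤ c i ∧ c i ≤ 2 * (n : ℤ) := fun i => by
    have h := Fintype.mem_piFinset.1 hcw.1 i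
    rw [Finset.mem_Icc] at h
    exact_mod_cast h
  have hb0 : (0 : ℤ) ≤ (b : ℤ) := Int.natCast_nonneg b
  refine ⟨?_, fun i hi => ?_⟩
  · have h := base_height_of_mem_cellEdges hec
    rw [hc0] at h
    constructor <;> linarith [h.1, h.2]
  · have h := spatial_of_mem_cellEdges hec hi
    have h1 := mul_le_mul_of_nonneg_left (hcI i).1 hb0
    have h2 := mul_le_mul_of_nonneg_left (show c i + 1 ≤ 2 * (n : ℤ) + 1 by linarith [(hcI i).2]) hb0
    constructor <;> linarith [h.1, h.2]

/-- The box containing the base points of the TOP-FACE plaquettes touching `Λ`: height exactly `b`, spatial coordinates in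
`[-2nb - 1, (2n+1)b - 1]`. -/
def topBox (b n : ℕ) : Finset (Site 4) :=
  Fintype.piFinset fun i : Fin 4 =>
    if i = 0 then {(b : ℤ)} else Finset.Icc (-(2 * (n : ℤ) * b) - 1) ((2 * (n : ℤ) + 1) * b - 1)

/-- Helper lemma `card_topBox` of the hairpin-Stokes chain (re-homed verbatim from the crux workfile; see the module docstring). -/
theorem card_topBox (b n : ℕ) : (topBox b n).card = ((4 * n + 1) * b + 1) ^ 3 := by
  rw [topBox, Fintype.card_piFinset, Fin.prod_univ_four, if_pos rfl, if_neg (show (1 : Fin 4) ≠ 0 by decide),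
    if_neg (show (2 : Fin 4) ≠ 0 by decide), if_neg (show (3 : Fin 4) ≠ 0 by decide), Finset.card_singleton,
    Int.card_Icc]
  have h : (2 * (n : ℤ) + 1) * b - 1 + 1 - (-(2 * (n : ℤ) * b) - 1) = (((4 * n + 1) * b + 1 : ℕ) : ℤ) := by
    push_cast; ring
  rw [h, Int.toNat_natCast]
  ring

/-- A top-face plaquette (base height `b`) touching `Λ` has its base point in `topBox b n`. -/
theorem mem_topBox_of_touching {b n : ℕ} {q : ZdPlaquette 4} (hq : q ∈ plaquettesTouching (rowRegion b n))
    (hq0 : q.1 0 = (b : ℤ)) : q.1 ∈ topBox b n := by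
  rw [mem_plaquettesTouching_iff] at hq
  obtain ⟨e, he⟩ := hq
  rw [Finset.mem_inter] at he
  obtain ⟨he1, he2⟩ := he
  rw [topBox, Fintype.mem_piFinset]
  intro i
  by_cases hi : i = 0
  · subst hi
    rw [if_pos rfl, Finset.mem_singleton, hq0]
  · rw [if_neg hi, Finset.mem_Icc]
    have hs := (box_of_mem_rowRegion he2).2 i hi
    simp only [plaquetteEdges, Finset.mem_insert, Finset.mem_singleton] at he1
    rcases he1 with rfl | rfl | rfl | rfl
    · dsimp only at hs
      constructor <;> linarith [hs.1, hs.2]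
    · dsimp only at hs
      rw [Pi.add_apply, Pi.single_apply] at hs
      split_ifs at hs <;> constructor <;> linarith [hs.1, hs.2]
    · dsimp only at hs
      rw [Pi.add_apply, Pi.single_apply] at hs
      split_ifs at hs <;> constructor <;> linarith [hs.1, hs.2]
    · dsimp only at hs
      constructor <;> linarith [hs.1, hs.2]

/-- **THE TOP-FACE COUNT (PROVED):** the plaquettes touching `Λ = rowRegion b n` whose base point has height `b` (in
particular all TOP-FACE plaquettes `(x, 0, j)`, `x 0 = b`, the only ones the layer twist changes) number
`≤ 6·((4n+1)b + 1)³ ≤ C(n) b³`. -/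
theorem card_touching_height_eq_le (b n : ℕ) :
    ((plaquettesTouching (rowRegion b n)).filter (fun q => q.1 0 = (b : ℤ))).card ≤
      Fintype.card {p : Fin 4 × Fin 4 // p.1 < p.2} * ((4 * n + 1) * b + 1) ^ 3 := by
  have hsub : (plaquettesTouching (rowRegion b n)).filter (fun q => q.1 0 = (b : ℤ)) ⊆
      topBox b n ×ˢ (Finset.univ : Finset {p : Fin 4 × Fin 4 // p.1 < p.2}) := by
    intro q hq
    rw [Finset.mem_filter] at hq
    exact Finset.mem_product.2 ⟨mem_topBox_of_touching hq.1 hq.2, Finset.mem_univ _⟩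
  refine (Finset.card_le_card hsub).trans ?_
  rw [Finset.card_product, card_topBox, Finset.card_univ, mul_comm]

end Counting

section TopFace

/-! ### The twisted configuration plaquette by plaquette (copied from `CruxIdea2RowFloorPoly.lean` §4m, which cannot be imported) -/

open scoped Matrix Matrix.Norms.Frobenius

variable {G : Type} [Group G] {N : ℕ} (ρ : G →* Matrix (Fin N) (Fin N) ℂ)

/-- `N − Re tr ρ(g) = ‖ρ(g) − 1‖²_F / 2` for unitary `ρ` (copy of the row-floor file's lemma). -/
theorem sub_re_trace_eq_norm_sq (hρu : ∀ g, ρ g ∈ Matrix.unitaryGroup (Fin N) ℂ) (g : G) :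
    (N : ℝ) - (ρ g).trace.re = ‖ρ g - 1‖ ^ 2 / 2 := by
  have hU : (ρ g)ᴴ * ρ g = 1 := Matrix.mem_unitaryGroup_iff'.1 (hρu g)
  have h1 : ‖ρ g - 1‖ ^ 2 = RCLike.re (Matrix.trace ((ρ g - 1)ᴴ * (ρ g - 1))) :=
    Matrix.frobenius_norm_sq_eq_re_trace _
  have h2 : (ρ g - 1)ᴴ * (ρ g - 1) = 2 • (1 : Matrix (Fin N) (Fin N) ℂ) - ρ g - (ρ g)ᴴ := by
    rw [Matrix.conjTranspose_sub, Matrix.conjTranspose_one, sub_mul, mul_sub, mul_sub, hU, one_mul,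
      mul_one, one_mul, two_smul]
    abel
  rw [h1, h2]
  simp only [Matrix.trace_sub, Matrix.trace_smul, Matrix.trace_one, Fintype.card_fin, map_sub,
    Matrix.trace_conjTranspose, RCLike.star_def, RCLike.conj_re]
  simp only [RCLike.re_to_complex, nsmul_eq_mul, Complex.mul_re]
  norm_num
  ring

/-- The twist changes only temporal links. -/
theorem topTwist_apply_of_dir_ne {b : ℕ} (k : Site 4 → G) (U : LGConfig 4 G) {e : ZdEdge 4} (he : e.2 ≠ 0) :
    topTwist b k U e = U e := by
  unfold topTwist; exact if_neg fun h => he h.1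

/-- **PROVED (cases, I).** A plaquette `(x, i, j)` (`j ≠ 0`) that is NOT a top-face plaquette (`¬(i = 0 ∧ x₀ = b)`) has the same
holonomy in the twisted configuration as in `σ` — whatever the twisting field `k`. -/
theorem plaquetteHolonomyZd_topTwist_of_not_topFace (b : ℕ) (k : Site 4 → G) (σ : LGConfig 4 G) (x : Site 4)
    {i j : Fin 4} (hj : j ≠ 0) (h : ¬ (i = 0 ∧ x 0 = (b : ℤ))) :
    plaquetteHolonomyZd (topTwist b k σ) x i j = plaquetteHolonomyZd σ x i j := by
  unfold plaquetteHolonomyZd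
  have e2 : topTwist b k σ (x + Pi.single i 1, j) = σ (x + Pi.single i 1, j) := topTwist_apply_of_dir_ne k σ hj
  have e4 : topTwist b k σ (x, j) = σ (x, j) := topTwist_apply_of_dir_ne k σ hj
  by_cases hi : i = 0
  · have hx : x 0 ≠ (b : ℤ) := fun hx => h ⟨hi, hx⟩
    have e1 : topTwist b k σ (x, i) = σ (x, i) := topTwist_apply_of_ne k σ hx
    have hx' : ((x + Pi.single j (1 : ℤ) : Site 4)) 0 ≠ (b : ℤ) := by
      rw [add_single_apply_zero, if_neg hj, add_zero]; exact hx
    have e3 : topTwist b k σ (x + Pi.single j 1, i) = σ (x + Pi.single j 1, i) := topTwist_apply_of_ne k σ hx'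
    rw [e1, e2, e3, e4]
  · have e1 : topTwist b k σ (x, i) = σ (x, i) := topTwist_apply_of_dir_ne k σ hi
    have e3 : topTwist b k σ (x + Pi.single j 1, i) = σ (x + Pi.single j 1, i) := topTwist_apply_of_dir_ne k σ hi
    rw [e1, e2, e3, e4]

/-- The LINK DEFECT of the twisting field `k` across the layer link `(y, j)`: `k(y)⁻¹ σ(y,j) k(y+e_j) σ(y,j)⁻¹` (`= 1` iff `k` is
covariantly constant along the link). -/
def linkDefect (k : Site 4 → G) (σ : LGConfig 4 G) (y : Site 4) (j : Fin 4) : G :=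
  (k y)⁻¹ * σ (y, j) * k (y + Pi.single j 1) * (σ (y, j))⁻¹

/-- **PROVED (cases, II).** A TOP-FACE plaquette `(x, 0, j)`, `x₀ = b`, `j ≠ 0`: its twisted holonomy is the untwisted one
multiplied by a conjugate of the link defect of `k` across the layer link `(x + e₀, j)`. -/
theorem plaquetteHolonomyZd_topTwist_topFace (b : ℕ) (k : Site 4 → G) (σ : LGConfig 4 G) (x : Site 4) {j : Fin 4}
    (hj : j ≠ 0) (hx : x 0 = (b : ℤ)) :
    plaquetteHolonomyZd (topTwist b k σ) x 0 j =
      σ (x, 0) * linkDefect k σ (x + Pi.single 0 1) j * (σ (x, 0))⁻¹ * plaquetteHolonomyZd σ x 0 j := by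
  unfold plaquetteHolonomyZd linkDefect
  have e1 : topTwist b k σ (x, 0) = σ (x, 0) * (k (x + Pi.single 0 1))⁻¹ := by
    unfold topTwist; exact if_pos ⟨rfl, hx⟩
  have e2 : topTwist b k σ (x + Pi.single 0 1, j) = σ (x + Pi.single 0 1, j) := topTwist_apply_of_dir_ne k σ hj
  have hx' : ((x + Pi.single j (1 : ℤ) : Site 4)) 0 = (b : ℤ) := by
    rw [add_single_apply_zero, if_neg hj, add_zero]; exact hx
  have e3 : topTwist b k σ (x + Pi.single j 1, 0) =
      σ (x + Pi.single j 1, 0) * (k (x + Pi.single j 1 + Pi.single 0 1))⁻¹ := by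
    unfold topTwist; exact if_pos ⟨rfl, hx'⟩
  have e4 : topTwist b k σ (x, j) = σ (x, j) := topTwist_apply_of_dir_ne k σ hj
  rw [e1, e2, e3, e4]
  have hc : x + Pi.single j (1 : ℤ) + Pi.single 0 1 = x + Pi.single 0 1 + Pi.single j 1 := add_right_comm _ _ _
  rw [hc]
  group

/-- **PROVED (algebra, I).** ENERGY OF A TOP-FACE PLAQUETTE of the twisted configuration: `≤ ‖ρ(link defect) − 1‖²_F +
2·φ_p(σ)` (`‖AB − 1‖ ≤ ‖A − 1‖ + ‖B − 1‖` for unitaries, conjugation invariance, `N − Re tr ρ U = ‖ρ U − 1‖²_F/2`). -/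
theorem topFace_energy_le (hρu : ∀ g, ρ g ∈ Matrix.unitaryGroup (Fin N) ℂ) (b : ℕ) (k : Site 4 → G)
    (σ : LGConfig 4 G) (x : Site 4) {j : Fin 4} (hj : j ≠ 0) (hx : x 0 = (b : ℤ)) :
    (N : ℝ) - plaquetteObs ρ x 0 j (topTwist b k σ) ≤
      ‖ρ (linkDefect k σ (x + Pi.single 0 1) j) - 1‖ ^ 2 + 2 * ((N : ℝ) - plaquetteObs ρ x 0 j σ) := by
  unfold plaquetteObs
  rw [plaquetteHolonomyZd_topTwist_topFace b k σ x hj hx, sub_re_trace_eq_norm_sq ρ hρu, sub_re_trace_eq_norm_sq ρ hρu]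
  have h1 : ‖ρ (σ (x, 0) * linkDefect k σ (x + Pi.single 0 1) j * (σ (x, 0))⁻¹ * plaquetteHolonomyZd σ x 0 j) - 1‖ ≤
      ‖ρ (linkDefect k σ (x + Pi.single 0 1) j) - 1‖ + ‖ρ (plaquetteHolonomyZd σ x 0 j) - 1‖ := by
    calc _ ≤ ‖ρ (σ (x, 0) * linkDefect k σ (x + Pi.single 0 1) j * (σ (x, 0))⁻¹) - 1‖ +
          ‖ρ (plaquetteHolonomyZd σ x 0 j) - 1‖ := norm_rho_mul_sub_one_le ρ hρu _ _
      _ = _ := by rw [norm_map_conj_sub_one ρ hρu]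
  nlinarith [h1, norm_nonneg (ρ (σ (x, 0) * linkDefect k σ (x + Pi.single 0 1) j * (σ (x, 0))⁻¹ *
    plaquetteHolonomyZd σ x 0 j) - 1), norm_nonneg (ρ (linkDefect k σ (x + Pi.single 0 1) j) - 1),
    norm_nonneg (ρ (plaquetteHolonomyZd σ x 0 j) - 1),
    sq_nonneg (‖ρ (linkDefect k σ (x + Pi.single 0 1) j) - 1‖ - ‖ρ (plaquetteHolonomyZd σ x 0 j) - 1‖)]

/-- The comb HAIRPIN holonomy across the layer link `(y, j)`: `W = stair(y)·σ(y,j)·stair(y+e_j)⁻¹` (a closed staircase loop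
through the comb root; `= 1` for flat `σ` in the layer — `stair_add_single_of_flatZd` — and identically for `j = 3`). -/
def hairpin (b R : ℕ) (σ : LGConfig 4 G) (y : Site 4) (j : Fin 4) : G :=
  stair b R σ y * σ (y, j) * (stair b R σ (y + Pi.single j 1))⁻¹

/-- **PROVED (algebra, II).** The link defect of the COMB is conjugate to the commutator `k₀⁻¹ W k₀ W⁻¹` of `k₀` with the
hairpin holonomy, hence `‖ρ(defect) − 1‖_F ≤ 2‖ρ(W) − 1‖_F`. -/
theorem norm_linkDefect_comb_le (hρu : ∀ g, ρ g ∈ Matrix.unitaryGroup (Fin N) ℂ) (b R : ℕ) (k₀ : G)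
    (σ : LGConfig 4 G) (y : Site 4) (j : Fin 4) :
    ‖ρ (linkDefect (comb b R k₀ σ) σ y j) - 1‖ ≤ 2 * ‖ρ (hairpin b R σ y j) - 1‖ := by
  have hD : linkDefect (comb b R k₀ σ) σ y j =
      (stair b R σ y)⁻¹ * (k₀⁻¹ * hairpin b R σ y j * k₀ * (hairpin b R σ y j)⁻¹) * (stair b R σ y)⁻¹⁻¹ := by
    unfold linkDefect comb hairpin; group
  rw [hD, norm_map_conj_sub_one ρ hρu]
  have h1 := norm_rho_mul_sub_one_le ρ hρu (k₀⁻¹ * hairpin b R σ y j * k₀) (hairpin b R σ y j)⁻¹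
  have h2 := norm_map_conj_sub_one ρ hρu k₀⁻¹ (hairpin b R σ y j)
  rw [inv_inv] at h2
  rw [norm_rho_inv_sub_one ρ hρu, h2] at h1
  linarith

/-- **PROVED (the top-face bound with the comb).** `energy_p(σ') ≤ 4‖ρ(W_p) − 1‖²_F + 2φ_p(σ)` for every top-face plaquette
`p = (x, 0, j)`, `W_p` the hairpin across the layer link above it.  What remains for R1d: the HAIRPIN STOKES bound
`‖ρ(W) − 1‖_F ≤ Σ_{hairpin plaquettes} ‖ρ(σ_q) − 1‖_F` (`≤ combLen y 2 + combLen y 3 ≤ 4R` plaquettes), Cauchy–Schwarz and counting. -/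
theorem topFace_energy_comb_le (hρu : ∀ g, ρ g ∈ Matrix.unitaryGroup (Fin N) ℂ) (b R : ℕ) (k₀ : G)
    (σ : LGConfig 4 G) (x : Site 4) {j : Fin 4} (hj : j ≠ 0) (hx : x 0 = (b : ℤ)) :
    (N : ℝ) - plaquetteObs ρ x 0 j (topTwist b (comb b R k₀ σ) σ) ≤
      4 * ‖ρ (hairpin b R σ (x + Pi.single 0 1) j) - 1‖ ^ 2 + 2 * ((N : ℝ) - plaquetteObs ρ x 0 j σ) := by
  have h1 := topFace_energy_le ρ hρu b (comb b R k₀ σ) σ x hj hx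
  have h2 := norm_linkDefect_comb_le ρ hρu b R k₀ σ (x + Pi.single 0 1) j
  have h0 := norm_nonneg (ρ (linkDefect (comb b R k₀ σ) σ (x + Pi.single 0 1) j) - 1)
  nlinarith [h1, h2, h0]

/-- **PROVED (cases, I, as energies).** Off the top face the twisted configuration has the plaquette energies of `σ`. -/
theorem energy_topTwist_of_not_topFace (b : ℕ) (k : Site 4 → G) (σ : LGConfig 4 G) (q : ZdPlaquette 4)
    (h : ¬ (q.2.1.1 = 0 ∧ q.1 0 = (b : ℤ))) :
    (N : ℝ) - plaquetteObs ρ q.1 q.2.1.1 q.2.1.2 (topTwist b k σ) = (N : ℝ) - plaquetteObs ρ q.1 q.2.1.1 q.2.1.2 σ := by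
  have hj : q.2.1.2 ≠ 0 := fun h0 => by have := q.2.2; rw [h0] at this; exact (Fin.not_lt_zero _) this
  unfold plaquetteObs
  rw [plaquetteHolonomyZd_topTwist_of_not_topFace b k σ q.1 hj h]


end TopFace

end Summit.QuantumFields.YangMills.Cruxes.IR.HairpinStokes

end
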